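import Literature.MathematicalPhysics.QuantumLattice.HubbardTTPrimeApexRow
import Literature.MathematicalPhysics.QuantumLattice.HubbardOneBodyKinematicRows
import HarnessLib

/-!
# The apex row AWAY FROM HALF FILLING: priced control of the diagonal-hopping energy replaces the
# half-filling sign `t'·K₂ ≤ 0`

Family `hubbard` (topic `MathematicalPhysics/QuantumLattice`; companion of `HubbardTTPrimeApexRow` §4, whose half-filling
conclusions it extends to every density `0 ≤ n < 2`). Written for the MO-S1/S2 seam of the Hubbard material oracle (cell
`pub/hubbard-downfold`, row "robustness lemmas: a parameter BOX maps to ONE certified word", seat `hubbard-downfold-unc-2`,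
filling / particle–hole lane): the DOPED boxes of the validation set. Everything is PROVED; no definition, no named fact, no number.

Coordinates as in the companion: `K₁(ω) = e_{Φ(1,0,0)}(ω)`, `K₂(ω) = e_{Φ(0,1,0)}(ω)`, `D(ω) = e_{Φ(0,0,1)}(ω)`,
`e_{Φ(t,t',U)}(ω) = t·K₁ + t'·K₂ + U·D`; `e(t,t',U,n) = energyDensityTT' t t' U n`.

WHY. The apex row (`IsTorusLimitOf.meanEnergy_twice_tPrime_le_of_groundStates_apex`) moves the one-body energy at the TARGET's
doubled hopping `2t'_P` from a source ground state `ω_A` at `A = (t'_A, U_A)` to the target `ω_P` at `P = (t'_P, U_P)` on the segment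
from the apex `(2t'_P, 0)`; the f-sum stiffness word at `P` is `−¼e_{Φ(1,2t'_P,0)}(ω_P)`. To feed it with the SOURCE's OWN certified
word (hopping `2t'_A`) one needs `e_{Φ(t,2t'_A,0)}(ω_A) ≤ e_{Φ(t,2t'_P,0)}(ω_A) + price`, i.e. control of
`(2t'_P − 2t'_A)·K₂(ω_A)` from below. At `n = 1` the sign `t'K₂ ≤ 0` makes the price zero (companion §4). At `n ≠ 1` this file
prices it by a FLOOR `B ≤ K₂(ω_A)` (for `t'_A ≤ t'_P`; a ceiling for the mirror orientation):

* §1 the MIRROR ROW, every density: `2t'·K₂(ω) ≤ e(t,t',U,n) − e(t,−t',U,n)` for every torus-limit ground state at `(t,t',U,n)`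
  (the supergradient inequality `HubbardTTPrimeMeanEnergySupergradient` §3 read at the mirror coupling `−t'`; at `n = 1` the right
  side vanishes by evenness — companion §4); its particle–hole form `… = e(t,t',U,n) − e(t,t',U,2−n) − U(n−1)`
  (`energyDensityTT'_particleHole'`); and the WINDOW form: a cap `e(t,t',U,n) ≤ u` and a floor `l ≤ e(t,−t',U,n)` give the floor word
  `(u − l)/(2t') ≤ K₂(ω)` when `t' < 0` (a ceiling word when `t' > 0`) — a `K₂` word from two ENERGY rows, no `K₂` objective;
* §2 the priced hopping comparison, every state: `B ≤ K₂(ω)`, `κ ≤ κ'` ⇒ `e_{Φ(t,κ,0)}(ω) + (κ' − κ)B ≤ e_{Φ(t,κ',0)}(ω)` (affine identity);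
* §3 the PRICED SOURCE COMPARISON on the apex segment: `0 ≤ U_A < U_P`, `U_P t'_A = (2U_P − U_A) t'_P`, `t'_A ≤ t'_P`, same density,
  `B ≤ K₂(ω_A)` ⇒ `e_{Φ(t,2t'_A,0)}(ω_A) + 2(t'_P − t'_A)·B ≤ e_{Φ(t,2t'_P,0)}(ω_P)` — the doped edition of
  `…meanEnergy_twice_tPrime_source_le_of_groundStates_apex_halfFilling` (there `B = 0`);
* §4 the PRICED REGION CHAIN: for a target with apex hopping `κ` between `2t'_A` and `2t'_P` (`U_A t'_P ≤ t'_A(2U_A − U_P)`,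
  `t'_A U_P ≤ t'_P(2U_P − U_A)`), floors `B_A ≤ K₂(ω_A)`, `B_P ≤ K₂(ω_P)` ⇒
  `e_{Φ(t,2t'_A,0)}(ω_A) + (κ − 2t'_A)B_A + (2t'_P − κ)B_P ≤ e_{Φ(t,2t'_P,0)}(ω_P)`;
* §5 the HYPOTHESIS-FREE floor: `−16/π² ≤ K₂(ω)` (`HubbardOneBodyKinematicRows`) prices §3 by `2(t'_P − t'_A)·16/π²` with no
  certificate at all.

What is NOT here: nothing toward smaller `U`; no sign of `K₂` away from half filling (there is none: the free Fermi sea at `n = 7/8`,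
`t' = −1/4` has `t'K₂ > 0`); no number. HONEST FRAMING: bookkeeping rows for certified stiffness CEILINGS; a ceiling never speaks to
the presence of order; not a superconductivity verdict.

## Mathlib / tree search

REUSED: `IsTorusLimitOf.energyDensityTT'_sub_le_mul_meanEnergy_diag` (supergradient, `t'`-direction), `energyDensityTT'_particleHole'`,
`meanEnergy_hubbardTTPrime_affine`, `IsTorusLimitOf.meanEnergy_twice_tPrime_le_of_groundStates_apex`,
`IsTorusLimitOf.meanEnergy_apexHopping_le_of_groundStates`, `IsTorusLimitOf.neg_sixteen_div_pi_sq_le_meanEnergy_diagHop`.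
`lean search 'diagHop|mirror' --decl`: the `n = 1` sign rows (`…_nonpos_of_groundState_halfFilling`, `HubbardTTPrimeDiagHopTransport` §7)
and the `t'`-monotone transport of `K₂` words (ibid. §1) exist; no priced apex comparison, no mirror window row at `n ≠ 1`.

## References

* T. Koma, H. Tasaki, J. Stat. Phys. 76 (1994) 745, §1 (variational / supergradient inequalities of ground-state energies in a
  coupling). [cite: KomaTasaki1994, §1]
* E. H. Lieb, F. Y. Wu, Physica A 321 (2003) 1, §1 eq. (3) (particle–hole symmetry of the Hubbard energy). [cite: LiebWuPhysicaA2003, §1 eq. (3)]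
* E. H. Lieb, M. Loss, Duke Math. J. 71 (1993) 337, §8 Thm 8.2 (one-body kinematic bound behind `|K₂| ≤ 16/π²`). [cite: LiebLoss1993, §8, Theorem 8.2]
* D. J. Scalapino, S. R. White, S.-C. Zhang, Phys. Rev. B 47 (1993) 7995, §II (the f-sum bound these rows serve). [cite: ScalapinoWhiteZhang1993, §II]
-/

noncomputable section

namespace Literature.MathematicalPhysics.QuantumLattice

open Matrix Finset HubbardWave0 Literature.Probability.LatticeModels ThermodynamicLimit
open _root_.Filter
open scoped _root_.Topology ComplexOrder BigOperators

namespace InfVolFermionState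

/-! ### §1 The mirror row: `2t'·K₂(ω) ≤ e(t,t',U,n) − e(t,−t',U,n)` at every density -/

/-- **Mirror row, every density.** `U ≥ 0`, `0 ≤ n < 2`; `ω` a torus limit of unit `(rectN n, S^z = 0)`-sector ground states of
`hubbardTorusTT' L t t' U`. Then `2t'·K₂(ω) ≤ e(t,t',U,n) − e(t,−t',U,n)`: the supergradient inequality at the anchor `(t,t',U)` read at
the mirror coupling `(t,−t',U)` (`e(t,−t',U,n) ≤ e_{Φ(t,−t',U)}(ω) = e(t,t',U,n) − 2t'K₂(ω)`). At `n = 1` the right side is `0`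
(`energyDensityTT'_particleHole_one`). [cite: KomaTasaki1994, §1] -/
theorem IsTorusLimitOf.two_mul_tPrime_mul_diagHop_le_sub_mirror (t t' : ℝ) {U : ℝ} (hU : 0 ≤ U) {n : ℝ}
    (hn0 : 0 ≤ n) (hn2 : n < 2)
    {ω : InfVolFermionState 2} {ψ : ∀ L, Fock (Orb (FermionTorus 2 L))} {Ls : ℕ → ℕ}
    (hω : ω.IsTorusLimitOf ψ Ls) (hLs : Tendsto Ls atTop atTop)
    (hψ : ∀ j, IsGroundStateInSector (hubbardTorusTT' (Ls j) t t' U) (rectN n (Ls j)) 0 (ψ (Ls j)))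
    (h1 : ∀ j, star (ψ (Ls j)) ⬝ᵥ ψ (Ls j) = 1) :
    2 * t' * ω.meanEnergy (hubbardTTPrimeFermionInteraction 0 1 0) 1 ≤
      energyDensityTT' t t' U n - energyDensityTT' t (-t') U n := by
  have h := hω.energyDensityTT'_sub_le_mul_meanEnergy_diag t t' hU hn0 hn2 hLs hψ h1 (-t')
  have e : (-t' - t') * ω.meanEnergy (hubbardTTPrimeFermionInteraction 0 1 0) 1 =
      -(2 * t' * ω.meanEnergy (hubbardTTPrimeFermionInteraction 0 1 0) 1) := by ring
  rw [e] at h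
  linarith

/-- **Mirror row, particle–hole form** (`0 < n < 2`): `2t'·K₂(ω) ≤ e(t,t',U,n) − e(t,t',U,2−n) − U(n−1)` — the mirror energy
`e(t,−t',U,n)` is the energy of the SAME Hamiltonian at the reflected density up to the explicit linear term
(`energyDensityTT'_particleHole'`), so a floor at the electron-doped twin `(t,t',U,2−n)` serves. [cite: KomaTasaki1994, §1] [cite: LiebWuPhysicaA2003, §1 eq. (3)] -/
theorem IsTorusLimitOf.two_mul_tPrime_mul_diagHop_le_sub_particleHole (t t' : ℝ) {U : ℝ} (hU : 0 ≤ U) {n : ℝ}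
    (hn0 : 0 < n) (hn2 : n < 2)
    {ω : InfVolFermionState 2} {ψ : ∀ L, Fock (Orb (FermionTorus 2 L))} {Ls : ℕ → ℕ}
    (hω : ω.IsTorusLimitOf ψ Ls) (hLs : Tendsto Ls atTop atTop)
    (hψ : ∀ j, IsGroundStateInSector (hubbardTorusTT' (Ls j) t t' U) (rectN n (Ls j)) 0 (ψ (Ls j)))
    (h1 : ∀ j, star (ψ (Ls j)) ⬝ᵥ ψ (Ls j) = 1) :
    2 * t' * ω.meanEnergy (hubbardTTPrimeFermionInteraction 0 1 0) 1 ≤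
      energyDensityTT' t t' U n - energyDensityTT' t t' U (2 - n) - U * (n - 1) := by
  have h := IsTorusLimitOf.two_mul_tPrime_mul_diagHop_le_sub_mirror t t' hU hn0.le hn2 hω hLs hψ h1
  rw [energyDensityTT'_particleHole' t t' hU hn0 hn2] at h
  linarith

/-- **Mirror WINDOW row, `t' < 0`: a floor word on `K₂` from two energy rows.** With a certified cap `e(t,t',U,n) ≤ u` at the
point and a certified floor `l ≤ e(t,−t',U,n)` at its mirror, every torus-limit ground state at `(t,t',U,n)` has
`(u − l)/(2t') ≤ K₂(ω)` — a floor word on `K₂` obtained from two ENERGY rows, with no `K₂` objective solved. [cite: KomaTasaki1994, §1] -/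
theorem IsTorusLimitOf.div_le_diagHop_of_mirror_window_of_neg (t : ℝ) {t' : ℝ} (ht' : t' < 0) {U : ℝ} (hU : 0 ≤ U)
    {n : ℝ} (hn0 : 0 ≤ n) (hn2 : n < 2) {u l : ℝ} (hu : energyDensityTT' t t' U n ≤ u)
    (hl : l ≤ energyDensityTT' t (-t') U n)
    {ω : InfVolFermionState 2} {ψ : ∀ L, Fock (Orb (FermionTorus 2 L))} {Ls : ℕ → ℕ}
    (hω : ω.IsTorusLimitOf ψ Ls) (hLs : Tendsto Ls atTop atTop)
    (hψ : ∀ j, IsGroundStateInSector (hubbardTorusTT' (Ls j) t t' U) (rectN n (Ls j)) 0 (ψ (Ls j)))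
    (h1 : ∀ j, star (ψ (Ls j)) ⬝ᵥ ψ (Ls j) = 1) :
    (u - l) / (2 * t') ≤ ω.meanEnergy (hubbardTTPrimeFermionInteraction 0 1 0) 1 := by
  have h := IsTorusLimitOf.two_mul_tPrime_mul_diagHop_le_sub_mirror t t' hU hn0 hn2 hω hLs hψ h1
  rw [div_le_iff_of_neg (by linarith)]
  linarith

/-- **Mirror WINDOW row, `t' > 0`: a ceiling word on `K₂`**: `K₂(ω) ≤ (u − l)/(2t')` under the same cap at the point and floor at
the mirror. [cite: KomaTasaki1994, §1] -/
theorem IsTorusLimitOf.diagHop_le_div_of_mirror_window_of_pos (t : ℝ) {t' : ℝ} (ht' : 0 < t') {U : ℝ} (hU : 0 ≤ U)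
    {n : ℝ} (hn0 : 0 ≤ n) (hn2 : n < 2) {u l : ℝ} (hu : energyDensityTT' t t' U n ≤ u)
    (hl : l ≤ energyDensityTT' t (-t') U n)
    {ω : InfVolFermionState 2} {ψ : ∀ L, Fock (Orb (FermionTorus 2 L))} {Ls : ℕ → ℕ}
    (hω : ω.IsTorusLimitOf ψ Ls) (hLs : Tendsto Ls atTop atTop)
    (hψ : ∀ j, IsGroundStateInSector (hubbardTorusTT' (Ls j) t t' U) (rectN n (Ls j)) 0 (ψ (Ls j)))
    (h1 : ∀ j, star (ψ (Ls j)) ⬝ᵥ ψ (Ls j) = 1) :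
    ω.meanEnergy (hubbardTTPrimeFermionInteraction 0 1 0) 1 ≤ (u - l) / (2 * t') := by
  have h := IsTorusLimitOf.two_mul_tPrime_mul_diagHop_le_sub_mirror t t' hU hn0 hn2 hω hLs hψ h1
  rw [le_div_iff₀ (by linarith)]
  linarith

/-! ### §2 The priced hopping comparison, every state -/

/-- **Priced hopping comparison.** For every state `ω`, every `t`, hoppings `κ ≤ κ'` and a floor `B ≤ K₂(ω)`:
`e_{Φ(t,κ,0)}(ω) + (κ' − κ)·B ≤ e_{Φ(t,κ',0)}(ω)` (`e_{Φ(t,κ',0)} − e_{Φ(t,κ,0)} = (κ' − κ)K₂`, `meanEnergy_hubbardTTPrime_affine`: the mean energy is affine in the couplings). [cite: KomaTasaki1994, §1] -/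
theorem meanEnergy_hopping_add_mul_le_of_le_diagHop (ω : InfVolFermionState 2) (t : ℝ) {κ κ' B : ℝ} (hκ : κ ≤ κ')
    (hB : B ≤ ω.meanEnergy (hubbardTTPrimeFermionInteraction 0 1 0) 1) :
    ω.meanEnergy (hubbardTTPrimeFermionInteraction t κ 0) 1 + (κ' - κ) * B ≤
      ω.meanEnergy (hubbardTTPrimeFermionInteraction t κ' 0) 1 := by
  rw [ω.meanEnergy_hubbardTTPrime_affine t κ 0 κ' 0, sub_self, zero_mul, add_zero]
  nlinarith [mul_le_mul_of_nonneg_left hB (sub_nonneg.2 hκ)]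

/-- **Priced hopping comparison, ceiling form**: `κ ≤ κ'`, `K₂(ω) ≤ A` ⇒ `e_{Φ(t,κ',0)}(ω) ≤ e_{Φ(t,κ,0)}(ω) + (κ' − κ)·A`. [cite: KomaTasaki1994, §1] -/
theorem meanEnergy_hopping_le_add_mul_of_diagHop_le (ω : InfVolFermionState 2) (t : ℝ) {κ κ' A : ℝ} (hκ : κ ≤ κ')
    (hA : ω.meanEnergy (hubbardTTPrimeFermionInteraction 0 1 0) 1 ≤ A) :
    ω.meanEnergy (hubbardTTPrimeFermionInteraction t κ' 0) 1 ≤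
      ω.meanEnergy (hubbardTTPrimeFermionInteraction t κ 0) 1 + (κ' - κ) * A := by
  rw [ω.meanEnergy_hubbardTTPrime_affine t κ 0 κ' 0, sub_self, zero_mul, add_zero]
  nlinarith [mul_le_mul_of_nonneg_left hA (sub_nonneg.2 hκ)]

/-! ### §3 The priced source comparison on the apex segment (any density) -/

/-- **Doped apex row: the source's own doubled hopping, priced by a `K₂` floor.** `0 ≤ U_A < U_P`, `U_P·t'_A = (2U_P − U_A)·t'_P`
(the source `A` on the segment from the apex `(2t'_P,0)` to `P`), `t'_A ≤ t'_P` (the `t' ≤ 0` orientation), density `0 ≤ n < 2`;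
`ω_A`, `ω_P` torus-limit ground states at `(t,t'_A,U_A,n)`, `(t,t'_P,U_P,n)`; `B ≤ K₂(ω_A)`. Then
`e_{Φ(t,2t'_A,0)}(ω_A) + 2(t'_P − t'_A)·B ≤ e_{Φ(t,2t'_P,0)}(ω_P)`. Reading: the f-sum stiffness ceiling at `P` is at most the
source's f-sum word plus `(t'_P − t'_A)·(−B)/2`; at `n = 1`, `t' < 0`, `B = 0` is free (companion §4). [cite: KomaTasaki1994, §1] [cite: ScalapinoWhiteZhang1993, §II] -/
theorem IsTorusLimitOf.meanEnergy_twice_tPrime_source_add_le_of_groundStates_apex (t t'A t'P : ℝ) {UA UP : ℝ}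
    (hUA : 0 ≤ UA) (hU : UA < UP) (hapex : UP * t'A = (2 * UP - UA) * t'P) (ht : t'A ≤ t'P)
    {n : ℝ} (hn0 : 0 ≤ n) (hn2 : n < 2)
    {ωA ωP : InfVolFermionState 2} {ψA ψP : ∀ L, Fock (Orb (FermionTorus 2 L))} {LsA LsP : ℕ → ℕ}
    (hA : ωA.IsTorusLimitOf ψA LsA) (hLsA : Tendsto LsA atTop atTop)
    (hψA : ∀ j, IsGroundStateInSector (hubbardTorusTT' (LsA j) t t'A UA) (rectN n (LsA j)) 0 (ψA (LsA j)))
    (h1A : ∀ j, star (ψA (LsA j)) ⬝ᵥ ψA (LsA j) = 1)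
    (hP : ωP.IsTorusLimitOf ψP LsP) (hLsP : Tendsto LsP atTop atTop)
    (hψP : ∀ j, IsGroundStateInSector (hubbardTorusTT' (LsP j) t t'P UP) (rectN n (LsP j)) 0 (ψP (LsP j)))
    (h1P : ∀ j, star (ψP (LsP j)) ⬝ᵥ ψP (LsP j) = 1) {B : ℝ}
    (hB : B ≤ ωA.meanEnergy (hubbardTTPrimeFermionInteraction 0 1 0) 1) :
    ωA.meanEnergy (hubbardTTPrimeFermionInteraction t (2 * t'A) 0) 1 + 2 * (t'P - t'A) * B ≤
      ωP.meanEnergy (hubbardTTPrimeFermionInteraction t (2 * t'P) 0) 1 := by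
  have hcmp := meanEnergy_hopping_add_mul_le_of_le_diagHop ωA t (κ := 2 * t'A) (κ' := 2 * t'P) (by linarith) hB
  have hapx := IsTorusLimitOf.meanEnergy_twice_tPrime_le_of_groundStates_apex t t'A t'P hUA hU hapex hn0 hn2 hA hLsA
    hψA h1A hP hLsP hψP h1P
  have e : (2 * t'P - 2 * t'A) * B = 2 * (t'P - t'A) * B := by ring
  linarith

/-! ### §4 The priced region chain (any density) -/

/-- **Doped apex REGION chain.** `0 ≤ U_A < U_P`, density `0 ≤ n < 2`, and the two side conditions
`U_A·t'_P ≤ t'_A·(2U_A − U_P)`, `t'_A·U_P ≤ t'_P·(2U_P − U_A)` (equivalently `2t'_A ≤ κ ≤ 2t'_P` for the apex hopping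
`κ = (U_P t'_A − U_A t'_P)/(U_P − U_A)` of the line `AP`); floors `B_A ≤ K₂(ω_A)`, `B_P ≤ K₂(ω_P)` on the two ground states. Then
`e_{Φ(t,2t'_A,0)}(ω_A) + (κ − 2t'_A)·B_A + (2t'_P − κ)·B_P ≤ e_{Φ(t,2t'_P,0)}(ω_P)`: source end (§2 at `ω_A`), apex row
(`…meanEnergy_apexHopping_le_of_groundStates`), target end (§2 at `ω_P`). At `n = 1`, `t' < 0`: `B_A = B_P = 0` (companion §4,
`StiffnessApexTransport` §5). [cite: KomaTasaki1994, §1] [cite: ScalapinoWhiteZhang1993, §II] -/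
theorem IsTorusLimitOf.meanEnergy_twice_tPrime_source_add_le_of_groundStates_apexRegion (t t'A t'P : ℝ) {UA UP : ℝ}
    (hUA : 0 ≤ UA) (hU : UA < UP) (h₁ : UA * t'P ≤ t'A * (2 * UA - UP)) (h₂ : t'A * UP ≤ t'P * (2 * UP - UA))
    {n : ℝ} (hn0 : 0 ≤ n) (hn2 : n < 2)
    {ωA ωP : InfVolFermionState 2} {ψA ψP : ∀ L, Fock (Orb (FermionTorus 2 L))} {LsA LsP : ℕ → ℕ}
    (hA : ωA.IsTorusLimitOf ψA LsA) (hLsA : Tendsto LsA atTop atTop)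
    (hψA : ∀ j, IsGroundStateInSector (hubbardTorusTT' (LsA j) t t'A UA) (rectN n (LsA j)) 0 (ψA (LsA j)))
    (h1A : ∀ j, star (ψA (LsA j)) ⬝ᵥ ψA (LsA j) = 1)
    (hP : ωP.IsTorusLimitOf ψP LsP) (hLsP : Tendsto LsP atTop atTop)
    (hψP : ∀ j, IsGroundStateInSector (hubbardTorusTT' (LsP j) t t'P UP) (rectN n (LsP j)) 0 (ψP (LsP j)))
    (h1P : ∀ j, star (ψP (LsP j)) ⬝ᵥ ψP (LsP j) = 1) {BA BP : ℝ}
    (hBA : BA ≤ ωA.meanEnergy (hubbardTTPrimeFermionInteraction 0 1 0) 1)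
    (hBP : BP ≤ ωP.meanEnergy (hubbardTTPrimeFermionInteraction 0 1 0) 1) :
    ωA.meanEnergy (hubbardTTPrimeFermionInteraction t (2 * t'A) 0) 1 +
        ((UP * t'A - UA * t'P) / (UP - UA) - 2 * t'A) * BA + (2 * t'P - (UP * t'A - UA * t'P) / (UP - UA)) * BP ≤
      ωP.meanEnergy (hubbardTTPrimeFermionInteraction t (2 * t'P) 0) 1 := by
  have hd : 0 < UP - UA := sub_pos.2 hU
  set κ : ℝ := (UP * t'A - UA * t'P) / (UP - UA) with hκ_def
  have hκmul : κ * (UP - UA) = UP * t'A - UA * t'P := by rw [hκ_def]; field_simp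
  have hκP : κ ≤ 2 * t'P := by nlinarith [hκmul, h₂, hd]
  have hκA : 2 * t'A ≤ κ := by nlinarith [hκmul, h₁, hd]
  -- source end
  have hsrc := meanEnergy_hopping_add_mul_le_of_le_diagHop ωA t hκA hBA
  -- apex row
  have hapx := IsTorusLimitOf.meanEnergy_apexHopping_le_of_groundStates t t'A t'P hUA hU hn0 hn2 hA hLsA hψA h1A
    hP hLsP hψP h1P
  simp only [← hκ_def] at hapx
  -- target end
  have htgt := meanEnergy_hopping_add_mul_le_of_le_diagHop ωP t hκP hBP
  linarith

/-! ### §5 The hypothesis-free price: `−16/π² ≤ K₂(ω)` -/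

/-- **Doped apex row with the KINEMATIC `K₂` floor (no certificate at the source beyond its own word).** Same geometry as §3
(`t'_A ≤ t'_P`): `e_{Φ(t,2t'_A,0)}(ω_A) − 2(t'_P − t'_A)·(16/π²) ≤ e_{Φ(t,2t'_P,0)}(ω_P)`, by `−16/π² ≤ K₂(ω_A)`
(`IsTorusLimitOf.neg_sixteen_div_pi_sq_le_meanEnergy_diagHop`). Reading: the source's f-sum word transports at the price
`(t'_P − t'_A)·8/π² ≤ 0.8106·(t'_P − t'_A)`. [cite: LiebLoss1993, §8, Theorem 8.2] [cite: KomaTasaki1994, §1] -/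
theorem IsTorusLimitOf.meanEnergy_twice_tPrime_source_sub_kinematic_le_of_groundStates_apex (t t'A t'P : ℝ) {UA UP : ℝ}
    (hUA : 0 ≤ UA) (hU : UA < UP) (hapex : UP * t'A = (2 * UP - UA) * t'P) (ht : t'A ≤ t'P)
    {n : ℝ} (hn0 : 0 ≤ n) (hn2 : n < 2)
    {ωA ωP : InfVolFermionState 2} {ψA ψP : ∀ L, Fock (Orb (FermionTorus 2 L))} {LsA LsP : ℕ → ℕ}
    (hA : ωA.IsTorusLimitOf ψA LsA) (hLsA : Tendsto LsA atTop atTop)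
    (hψA : ∀ j, IsGroundStateInSector (hubbardTorusTT' (LsA j) t t'A UA) (rectN n (LsA j)) 0 (ψA (LsA j)))
    (h1A : ∀ j, star (ψA (LsA j)) ⬝ᵥ ψA (LsA j) = 1)
    (hP : ωP.IsTorusLimitOf ψP LsP) (hLsP : Tendsto LsP atTop atTop)
    (hψP : ∀ j, IsGroundStateInSector (hubbardTorusTT' (LsP j) t t'P UP) (rectN n (LsP j)) 0 (ψP (LsP j)))
    (h1P : ∀ j, star (ψP (LsP j)) ⬝ᵥ ψP (LsP j) = 1) :
    ωA.meanEnergy (hubbardTTPrimeFermionInteraction t (2 * t'A) 0) 1 - 2 * (t'P - t'A) * (16 / Real.pi ^ 2) ≤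
      ωP.meanEnergy (hubbardTTPrimeFermionInteraction t (2 * t'P) 0) 1 := by
  have hN : ∀ j, IsNParticle (rectN n (LsA j)) (ψA (LsA j)) := fun j => ((mem_szSector_iff _ _ _).1 (hψA j).1).1
  have hB := hA.neg_sixteen_div_pi_sq_le_meanEnergy_diagHop hn0 hn2 hLsA hN h1A
  have h := IsTorusLimitOf.meanEnergy_twice_tPrime_source_add_le_of_groundStates_apex t t'A t'P hUA hU hapex ht hn0 hn2
    hA hLsA hψA h1A hP hLsP hψP h1P (B := -(16 / Real.pi ^ 2)) (by simpa only [neg_div] using hB)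
  linarith

/-! ### §6 The particle–hole window form of the `K₂` floor (near half filling it costs only the window width) -/

/-- **Mirror window row in particle–hole form, `t' < 0`, `0 < n < 2`.** A cap `e(t,t',U,n) ≤ u` at the point and a floor
`l₂ ≤ e(t,t',U,2−n)` at the SAME hopping and the REFLECTED density give the floor word `(u − l₂ − U(n−1))/(2t') ≤ K₂(ω)` on every
torus-limit ground state at `(t,t',U,n)` (§1 with `e(t,−t',U,n) = e(t,t',U,2−n) + U(n−1)`). Near `n = 1` both energy rows come from
ONE window certificate read at the two densities (density-affine rows), so the floor costs the window width plus the density slopes.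
[cite: KomaTasaki1994, §1] [cite: LiebWuPhysicaA2003, §1 eq. (3)] -/
theorem IsTorusLimitOf.div_le_diagHop_of_particleHole_window_of_neg (t : ℝ) {t' : ℝ} (ht' : t' < 0) {U : ℝ} (hU : 0 ≤ U)
    {n : ℝ} (hn0 : 0 < n) (hn2 : n < 2) {u l₂ : ℝ} (hu : energyDensityTT' t t' U n ≤ u)
    (hl : l₂ ≤ energyDensityTT' t t' U (2 - n))
    {ω : InfVolFermionState 2} {ψ : ∀ L, Fock (Orb (FermionTorus 2 L))} {Ls : ℕ → ℕ}
    (hω : ω.IsTorusLimitOf ψ Ls) (hLs : Tendsto Ls atTop atTop)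
    (hψ : ∀ j, IsGroundStateInSector (hubbardTorusTT' (Ls j) t t' U) (rectN n (Ls j)) 0 (ψ (Ls j)))
    (h1 : ∀ j, star (ψ (Ls j)) ⬝ᵥ ψ (Ls j) = 1) :
    (u - l₂ - U * (n - 1)) / (2 * t') ≤ ω.meanEnergy (hubbardTTPrimeFermionInteraction 0 1 0) 1 := by
  have h := IsTorusLimitOf.two_mul_tPrime_mul_diagHop_le_sub_particleHole t t' hU hn0 hn2 hω hLs hψ h1
  rw [div_le_iff_of_neg (by linarith)]
  linarith

/-- **The same, `t' > 0` (ceiling orientation)**: `K₂(ω) ≤ (u − l₂ − U(n−1))/(2t')`. [cite: KomaTasaki1994, §1] [cite: LiebWuPhysicaA2003, §1 eq. (3)] -/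
theorem IsTorusLimitOf.diagHop_le_div_of_particleHole_window_of_pos (t : ℝ) {t' : ℝ} (ht' : 0 < t') {U : ℝ} (hU : 0 ≤ U)
    {n : ℝ} (hn0 : 0 < n) (hn2 : n < 2) {u l₂ : ℝ} (hu : energyDensityTT' t t' U n ≤ u)
    (hl : l₂ ≤ energyDensityTT' t t' U (2 - n))
    {ω : InfVolFermionState 2} {ψ : ∀ L, Fock (Orb (FermionTorus 2 L))} {Ls : ℕ → ℕ}
    (hω : ω.IsTorusLimitOf ψ Ls) (hLs : Tendsto Ls atTop atTop)
    (hψ : ∀ j, IsGroundStateInSector (hubbardTorusTT' (Ls j) t t' U) (rectN n (Ls j)) 0 (ψ (Ls j)))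
    (h1 : ∀ j, star (ψ (Ls j)) ⬝ᵥ ψ (Ls j) = 1) :
    ω.meanEnergy (hubbardTTPrimeFermionInteraction 0 1 0) 1 ≤ (u - l₂ - U * (n - 1)) / (2 * t') := by
  have h := IsTorusLimitOf.two_mul_tPrime_mul_diagHop_le_sub_particleHole t t' hU hn0 hn2 hω hLs hψ h1
  rw [le_div_iff₀ (by linarith)]
  linarith

/-! ### §7 TWO point sources BRACKETING the target: no `K₂` input on the target class -/

/-- **Two-source bracket row (any density).** Station `U_A ≥ 0`, target `P = (t'_P, U_P)` with `U_A < U_P`, two sources `s₁ < s₂` at the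
station, same density; apex hoppings `κ_i = (U_P s_i − U_A t'_P)/(U_P − U_A)` with `κ₁ ≤ 2t'_P ≤ κ₂` (the sources BRACKET the apex-segment
parameter of `P`) and `2s_i ≤ κ_i` (floor orientation at both sources); floors `B_i ≤ K₂(ω_i)`. Then
`min_i [e_{Φ(t,2s_i,0)}(ω_i) + (κ_i − 2s_i)B_i] ≤ e_{Φ(t,2t'_P,0)}(ω_P)`: priced source ends (§2), the two apex rows, and AFFINE INTERPOLATION in
the hopping slot AT THE TARGET — `(κ₂ − κ₁)e_{Φ(t,2t'_P,0)} = (κ₂ − 2t'_P)e_{Φ(t,κ₁,0)} + (2t'_P − κ₁)e_{Φ(t,κ₂,0)}` on `ω_P` — so NO word on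
the target class is needed (the doped analogue of the one-point region at `n = 1`). [cite: KomaTasaki1994, §1] [cite: ScalapinoWhiteZhang1993, §II] -/
theorem IsTorusLimitOf.min_twice_source_add_le_of_groundStates_twoApexSources (t s₁ s₂ t'P : ℝ) {UA UP : ℝ}
    (hUA : 0 ≤ UA) (hU : UA < UP) (hs : s₁ < s₂)
    (hlo : UP * s₁ - UA * t'P ≤ 2 * t'P * (UP - UA)) (hhi : 2 * t'P * (UP - UA) ≤ UP * s₂ - UA * t'P)
    (h2s₁ : 2 * s₁ * (UP - UA) ≤ UP * s₁ - UA * t'P) (h2s₂ : 2 * s₂ * (UP - UA) ≤ UP * s₂ - UA * t'P)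
    {n : ℝ} (hn0 : 0 ≤ n) (hn2 : n < 2)
    {ω₁ ω₂ ωP : InfVolFermionState 2} {ψ₁ ψ₂ ψP : ∀ L, Fock (Orb (FermionTorus 2 L))} {Ls₁ Ls₂ LsP : ℕ → ℕ}
    (hω₁ : ω₁.IsTorusLimitOf ψ₁ Ls₁) (hLs₁ : Tendsto Ls₁ atTop atTop)
    (hψ₁ : ∀ j, IsGroundStateInSector (hubbardTorusTT' (Ls₁ j) t s₁ UA) (rectN n (Ls₁ j)) 0 (ψ₁ (Ls₁ j)))
    (h1₁ : ∀ j, star (ψ₁ (Ls₁ j)) ⬝ᵥ ψ₁ (Ls₁ j) = 1)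
    (hω₂ : ω₂.IsTorusLimitOf ψ₂ Ls₂) (hLs₂ : Tendsto Ls₂ atTop atTop)
    (hψ₂ : ∀ j, IsGroundStateInSector (hubbardTorusTT' (Ls₂ j) t s₂ UA) (rectN n (Ls₂ j)) 0 (ψ₂ (Ls₂ j)))
    (h1₂ : ∀ j, star (ψ₂ (Ls₂ j)) ⬝ᵥ ψ₂ (Ls₂ j) = 1)
    (hP : ωP.IsTorusLimitOf ψP LsP) (hLsP : Tendsto LsP atTop atTop)
    (hψP : ∀ j, IsGroundStateInSector (hubbardTorusTT' (LsP j) t t'P UP) (rectN n (LsP j)) 0 (ψP (LsP j)))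
    (h1P : ∀ j, star (ψP (LsP j)) ⬝ᵥ ψP (LsP j) = 1) {B₁ B₂ : ℝ}
    (hB₁ : B₁ ≤ ω₁.meanEnergy (hubbardTTPrimeFermionInteraction 0 1 0) 1)
    (hB₂ : B₂ ≤ ω₂.meanEnergy (hubbardTTPrimeFermionInteraction 0 1 0) 1) :
    min (ω₁.meanEnergy (hubbardTTPrimeFermionInteraction t (2 * s₁) 0) 1 +
          ((UP * s₁ - UA * t'P) / (UP - UA) - 2 * s₁) * B₁)
        (ω₂.meanEnergy (hubbardTTPrimeFermionInteraction t (2 * s₂) 0) 1 +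
          ((UP * s₂ - UA * t'P) / (UP - UA) - 2 * s₂) * B₂) ≤
      ωP.meanEnergy (hubbardTTPrimeFermionInteraction t (2 * t'P) 0) 1 := by
  have hd : 0 < UP - UA := sub_pos.2 hU
  set κ₁ : ℝ := (UP * s₁ - UA * t'P) / (UP - UA) with hκ₁_def
  set κ₂ : ℝ := (UP * s₂ - UA * t'P) / (UP - UA) with hκ₂_def
  have hκ₁mul : κ₁ * (UP - UA) = UP * s₁ - UA * t'P := by rw [hκ₁_def]; field_simp
  have hκ₂mul : κ₂ * (UP - UA) = UP * s₂ - UA * t'P := by rw [hκ₂_def]; field_simp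
  have hκ₁P : κ₁ ≤ 2 * t'P := by nlinarith [hκ₁mul, hlo, hd]
  have hκ₂P : 2 * t'P ≤ κ₂ := by nlinarith [hκ₂mul, hhi, hd]
  have hκ₁s : 2 * s₁ ≤ κ₁ := by nlinarith [hκ₁mul, h2s₁, hd]
  have hκ₂s : 2 * s₂ ≤ κ₂ := by nlinarith [hκ₂mul, h2s₂, hd]
  have hκ : κ₁ < κ₂ := by nlinarith [hκ₁mul, hκ₂mul, hs, hd, hUA.trans_lt hU]
  -- source ends (priced) and apex rows
  have hsrc₁ := meanEnergy_hopping_add_mul_le_of_le_diagHop ω₁ t hκ₁s hB₁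
  have hsrc₂ := meanEnergy_hopping_add_mul_le_of_le_diagHop ω₂ t hκ₂s hB₂
  have hapx₁ := IsTorusLimitOf.meanEnergy_apexHopping_le_of_groundStates t s₁ t'P hUA hU hn0 hn2 hω₁ hLs₁ hψ₁ h1₁
    hP hLsP hψP h1P
  have hapx₂ := IsTorusLimitOf.meanEnergy_apexHopping_le_of_groundStates t s₂ t'P hUA hU hn0 hn2 hω₂ hLs₂ hψ₂ h1₂
    hP hLsP hψP h1P
  simp only [← hκ₁_def] at hapx₁
  simp only [← hκ₂_def] at hapx₂
  -- affine interpolation at the target, in coordinates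
  rw [ωP.meanEnergy_hubbardTTPrime_eq_coords t κ₁ 0] at hapx₁
  rw [ωP.meanEnergy_hubbardTTPrime_eq_coords t κ₂ 0] at hapx₂
  rw [ωP.meanEnergy_hubbardTTPrime_eq_coords t (2 * t'P) 0]
  set K₁ := ωP.meanEnergy (hubbardTTPrimeFermionInteraction 1 0 0) 1
  set K₂ := ωP.meanEnergy (hubbardTTPrimeFermionInteraction 0 1 0) 1
  set f₁ := ω₁.meanEnergy (hubbardTTPrimeFermionInteraction t (2 * s₁) 0) 1 + (κ₁ - 2 * s₁) * B₁
  set f₂ := ω₂.meanEnergy (hubbardTTPrimeFermionInteraction t (2 * s₂) 0) 1 + (κ₂ - 2 * s₂) * B₂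
  have hf₁ : f₁ ≤ t * K₁ + κ₁ * K₂ + 0 * ωP.meanEnergy (hubbardTTPrimeFermionInteraction 0 0 1) 1 := by linarith
  have hf₂ : f₂ ≤ t * K₁ + κ₂ * K₂ + 0 * ωP.meanEnergy (hubbardTTPrimeFermionInteraction 0 0 1) 1 := by linarith
  have hw₁ : 0 ≤ κ₂ - 2 * t'P := by linarith
  have hw₂ : 0 ≤ 2 * t'P - κ₁ := by linarith
  have p₁ := mul_le_mul_of_nonneg_left (min_le_left f₁ f₂ |>.trans hf₁) hw₁
  have p₂ := mul_le_mul_of_nonneg_left (min_le_right f₁ f₂ |>.trans hf₂) hw₂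
  have key : (κ₂ - κ₁) * min f₁ f₂ ≤
      (κ₂ - κ₁) * (t * K₁ + 2 * t'P * K₂ + 0 * ωP.meanEnergy (hubbardTTPrimeFermionInteraction 0 0 1) 1) := by
    nlinarith [p₁, p₂]
  exact le_of_mul_le_mul_left key (by linarith)

/-! ### §8 The mirror orientation (`t'_P ≤ t'_A`: a `K₂` CEILING prices the source) and the sign-free kinematic row -/

/-- **Doped apex row, ceiling orientation.** `0 ≤ U_A < U_P`, `U_P·t'_A = (2U_P − U_A)·t'_P`, `t'_P ≤ t'_A` (the `t' ≥ 0` side: the source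
sits at LARGER `t'` than the target), same density, `K₂(ω_A) ≤ A`. Then `e_{Φ(t,2t'_A,0)}(ω_A) + 2(t'_P − t'_A)·A ≤ e_{Φ(t,2t'_P,0)}(ω_P)`
(the coefficient `2(t'_P − t'_A) ≤ 0` turns the ceiling into a floor on the increment). At `n = 1`, `t' > 0`: `A = 0` is free (companion §4).
[cite: KomaTasaki1994, §1] [cite: ScalapinoWhiteZhang1993, §II] -/
theorem IsTorusLimitOf.meanEnergy_twice_tPrime_source_add_le_of_groundStates_apex_of_diagHop_le (t t'A t'P : ℝ) {UA UP : ℝ}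
    (hUA : 0 ≤ UA) (hU : UA < UP) (hapex : UP * t'A = (2 * UP - UA) * t'P) (ht : t'P ≤ t'A)
    {n : ℝ} (hn0 : 0 ≤ n) (hn2 : n < 2)
    {ωA ωP : InfVolFermionState 2} {ψA ψP : ∀ L, Fock (Orb (FermionTorus 2 L))} {LsA LsP : ℕ → ℕ}
    (hA : ωA.IsTorusLimitOf ψA LsA) (hLsA : Tendsto LsA atTop atTop)
    (hψA : ∀ j, IsGroundStateInSector (hubbardTorusTT' (LsA j) t t'A UA) (rectN n (LsA j)) 0 (ψA (LsA j)))
    (h1A : ∀ j, star (ψA (LsA j)) ⬝ᵥ ψA (LsA j) = 1)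
    (hP : ωP.IsTorusLimitOf ψP LsP) (hLsP : Tendsto LsP atTop atTop)
    (hψP : ∀ j, IsGroundStateInSector (hubbardTorusTT' (LsP j) t t'P UP) (rectN n (LsP j)) 0 (ψP (LsP j)))
    (h1P : ∀ j, star (ψP (LsP j)) ⬝ᵥ ψP (LsP j) = 1) {A : ℝ}
    (hAK : ωA.meanEnergy (hubbardTTPrimeFermionInteraction 0 1 0) 1 ≤ A) :
    ωA.meanEnergy (hubbardTTPrimeFermionInteraction t (2 * t'A) 0) 1 + 2 * (t'P - t'A) * A ≤
      ωP.meanEnergy (hubbardTTPrimeFermionInteraction t (2 * t'P) 0) 1 := by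
  -- read the ceiling form from `2t'_P` up to `2t'_A`: `e(2t'_A) ≤ e(2t'_P) + (2t'_A − 2t'_P)·A` on `ω_A`
  have hcmp := meanEnergy_hopping_le_add_mul_of_diagHop_le ωA t (κ := 2 * t'P) (κ' := 2 * t'A) (by linarith) hAK
  have hapx := IsTorusLimitOf.meanEnergy_twice_tPrime_le_of_groundStates_apex t t'A t'P hUA hU hapex hn0 hn2 hA hLsA
    hψA h1A hP hLsP hψP h1P
  have e : (2 * t'A - 2 * t'P) * A = -(2 * (t'P - t'A) * A) := by ring
  linarith

/-- **Doped apex row, SIGN-FREE KINEMATIC form.** Same geometry, EITHER orientation: `e_{Φ(t,2t'_A,0)}(ω_A) − 2|t'_P − t'_A|·(16/π²) ≤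
e_{Φ(t,2t'_P,0)}(ω_P)` (`|K₂(ω_A)| ≤ 16/π²`, `IsTorusLimitOf.abs_meanEnergy_diagHop_le`). Reading: with no `K₂` word at all the source's f-sum word
transports at the price `|t'_P − t'_A|·8/π² < 0.8105695·|t'_P − t'_A|`, on the `t' > 0` side as on the `t' < 0` side. [cite: LiebLoss1993, §8, Theorem 8.2] [cite: KomaTasaki1994, §1] -/
theorem IsTorusLimitOf.meanEnergy_twice_tPrime_source_sub_abs_kinematic_le_of_groundStates_apex (t t'A t'P : ℝ) {UA UP : ℝ}
    (hUA : 0 ≤ UA) (hU : UA < UP) (hapex : UP * t'A = (2 * UP - UA) * t'P)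
    {n : ℝ} (hn0 : 0 ≤ n) (hn2 : n < 2)
    {ωA ωP : InfVolFermionState 2} {ψA ψP : ∀ L, Fock (Orb (FermionTorus 2 L))} {LsA LsP : ℕ → ℕ}
    (hA : ωA.IsTorusLimitOf ψA LsA) (hLsA : Tendsto LsA atTop atTop)
    (hψA : ∀ j, IsGroundStateInSector (hubbardTorusTT' (LsA j) t t'A UA) (rectN n (LsA j)) 0 (ψA (LsA j)))
    (h1A : ∀ j, star (ψA (LsA j)) ⬝ᵥ ψA (LsA j) = 1)
    (hP : ωP.IsTorusLimitOf ψP LsP) (hLsP : Tendsto LsP atTop atTop)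
    (hψP : ∀ j, IsGroundStateInSector (hubbardTorusTT' (LsP j) t t'P UP) (rectN n (LsP j)) 0 (ψP (LsP j)))
    (h1P : ∀ j, star (ψP (LsP j)) ⬝ᵥ ψP (LsP j) = 1) :
    ωA.meanEnergy (hubbardTTPrimeFermionInteraction t (2 * t'A) 0) 1 - 2 * |t'P - t'A| * (16 / Real.pi ^ 2) ≤
      ωP.meanEnergy (hubbardTTPrimeFermionInteraction t (2 * t'P) 0) 1 := by
  have hN : ∀ j, IsNParticle (rectN n (LsA j)) (ψA (LsA j)) := fun j => ((mem_szSector_iff _ _ _).1 (hψA j).1).1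
  have habs := hA.abs_meanEnergy_diagHop_le hn0 hn2 hLsA hN h1A
  obtain ⟨hlo, hhi⟩ := abs_le.1 habs
  rcases le_total t'A t'P with ht | ht
  · have h := IsTorusLimitOf.meanEnergy_twice_tPrime_source_add_le_of_groundStates_apex t t'A t'P hUA hU hapex ht hn0 hn2
      hA hLsA hψA h1A hP hLsP hψP h1P hlo
    rw [abs_of_nonneg (sub_nonneg.2 ht)]
    linarith
  · have h := IsTorusLimitOf.meanEnergy_twice_tPrime_source_add_le_of_groundStates_apex_of_diagHop_le t t'A t'P hUA hU
      hapex ht hn0 hn2 hA hLsA hψA h1A hP hLsP hψP h1P hhi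
    rw [abs_of_nonpos (sub_nonpos.2 ht)]
    linarith

end InfVolFermionState

end Literature.MathematicalPhysics.QuantumLattice

end
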